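import Summits.QuantumFields.BalabanUV.Gaps.D1BorderPencilSymmetry
import Summits.QuantumFields.BalabanUV.Gaps.D1WardSolvableColourSet
import Summits.QuantumFields.BalabanUV.Gaps.D1PinnedColourPolynomial

/-!
# `BalabanUV.Gaps.D1WardNoFreeKnob` — cell pub-balaban-gaps, row (D1), seat g1-p1: UNDER THE WARD BINDER AT ONE LEVEL THE β-LEAD's TWO CONTINUOUS KNOBS (border weight, table coordinate
# along a line) ARE QUARTIC POLYNOMIALS OF PRINT's COLOUR TRIPLE, AND (D1) IS ONE QUARTIC EQUATION IN THE COLOUR TRIPLE ALONE — no free continuous parameter left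

HONEST FRAMING (cell rule, page 1 of everything): [folklore] algebra BY NAME — GEN 13's universal normal form `lim β⁰(r, c⃗; cB, Tc) = γ_r + Φ(c⃗) + cB·σ_r + Λ(Tc)`
(`D1PinnedColourPolynomial.d1Drift_iff_normalForm_universal`, `Λ` ℝ-linear), GEN 16's joint (border weight, table line) pencil and Cramer uniqueness (`D1BorderPencilSymmetry`,
`D1SymmetryPencil.ward_pencil₂_formula`), GEN 16's entry-polynomial lemma for Ward defects (`D1WardSolvableColourSet.wardDefect_eq_eval_mvPolynomial`), GEN 12's colour-universality of data
differences (`D1PinnedResponseTowers.T2Of_dataDiff_universal`).  The printed Ward identity (5.9) [Balaban1987RG1 p. 293] is a PREDICATE on members of the cells' OWN pinned family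
`JsBalAn1(r; c⃗; Lc^8; cB; T)` ((P6) undecided); the «nonzero 2×2 determinant of defects» is a HYPOTHESIS (by value met for the record twin at level 0: RESULT-4, zero weight).  Nothing of
Bałaban's asserted; NO coefficient computed or signed; (D1) NOT discharged; 0∕4 row-D1 binders; NOT `BetaPertH`, NOT continuum, NOT Clay.
HONEST DEPENDENCY (b2b cell, verbatim): «continuum YM on T⁴ ⇐ BetaPertH ∧ nine spine estimates (0/9 proved); BetaPertH ⇐ (D1) ∧ (D4) ∧ CAP+tail; G-an2-4 gates asym, D1 and NE2/3/4.»

CONTENT (all [folklore]; no `def`, 0 sorry): §1 `unitTable_colour_free` (the unit TABLE tower `T_j(c⃗; 0; T₁) − T_j(c⃗; 0; T₀)` of a table line does not see the colour triple — GEN 12's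
`T2Of_dataDiff_universal`), `unitTable_wardDefect_colour_free`; §2 **`wardKnobs_eq_eval_mvPolynomial`** — fix a level `j`, a root, a table line `T₀, T₁` and two Ward-defect entries at which
the 2×2 determinant of (unit border tower, unit table tower) is nonzero: there are TWO real polynomials `R_B, R_S` in three variables, total degree ≤ 4, no linear part, such that for EVERY
colour triple, border weight `cB` and table coordinate `s`, `hW` at level `j` for the member `(c⃗; cB; (1−s)T₀ + sT₁)` forces `cB = eval c⃗ R_B` AND `s = eval c⃗ R_S`; §3
**`d1Drift_iff_wardNoFreeKnob`** — with GEN 13's universal `Φ, Λ` and per-root `γ, σ`: under the same hypotheses there is ONE `E`, `E.totalDegree ≤ 4`, `E.homogeneousComponent 1 = 0`, with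
`hW_j(c⃗; cB; T_s)` ⟹ ( `D1Drift … N μ ν` ⟺ `γ + eval c⃗ E + Λ T₀ = stepBal N Lc` ) — ONE quartic equation in the colour triple, NO border weight, NO table coordinate.

Provenance: cell pub-balaban-gaps, seat g1-p1 GEN 16 (prover-pub-balaban-gaps-g1-p1-g16-0), 2026-08-25; imports `Gaps/D1BorderPencilSymmetry` + `Gaps/D1WardSolvableColourSet` (this seat) +
`Gaps/D1PinnedColourPolynomial` (p391905 ✓); no existing file touched.
-/

noncomputable section

open Literature.MathematicalPhysics.QuantumFieldTheory Balaban1983to89 Balaban1983to89.Beta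
open B6BondElimination (unitVec)
open OneStepResolventKernel (JetData)
open OneStepKernelFamily (TbalOf flipK D1Drift)
open PolarizationSign (WardTransversal)
open AffineAveraging (box toSite)
open AveragingMixedJetTables (vh₂SAt mixFFAt)
open Summit.QuantumFields.BalabanUV.Beta.MixedJetTablesPlug (JsBalAn1 hB_an1 hmix_an1)
open Summit.QuantumFields.BalabanUV.Beta.GAN24.StencilSlotOfE3 (one_le_of_two_le)
open Summit.QuantumFields.BalabanUV.Gaps.D1PinnedResponseTowers (T2Of_dataDiff_universal TbalOf_JsBalAn1_dataDiff)
open Summit.QuantumFields.BalabanUV.Gaps.D1PinnedColourPolynomial (d1Drift_iff_normalForm_universal)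
open Summit.QuantumFields.BalabanUV.Gaps.D1SymmetryPencil
open Summit.QuantumFields.BalabanUV.Gaps.D1BorderPencilSymmetry (flipK_TbalOf_JsBalAn1_border_table_affine)
open Summit.QuantumFields.BalabanUV.Gaps.D1WardSolvableColourSet (wardDefect_eq_eval_mvPolynomial unitBorder_wardDefect_colour_free mvPolynomial_combination_deg_le_four)

namespace Summit.QuantumFields.BalabanUV.Gaps.D1WardNoFreeKnob

variable {Lc : ℕ} [NeZero Lc] {r : Fin (3 + 1) → ℕ}

/-! ## §1 The unit table tower of a table line is colour-free -/

/-- [folklore] **THE UNIT TABLE TOWER DOES NOT SEE THE COLOUR TRIPLE, ENTRYWISE**: `T_j(c⃗; 0; T₁) − T_j(c⃗; 0; T₀) = T_j(c⃗′; 0; T₁) − T_j(c⃗′; 0; T₀)` (GEN 12's `TbalOf_JsBalAn1_dataDiff` +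
`T2Of_dataDiff_universal`; any `1 ≤ Lc`, `cE₂`). -/
theorem unitTable_colour_free (hLc : 1 ≤ Lc) (hr : r ∈ box (3 + 1) Lc) (cE cVH cΛ cE' cVH' cΛ' cE₂ : ℝ) (T₀ T₁ : Fin 4 → Fin 4 → Fin 4 → Fin 4 → ℝ) (j : ℕ) (μ ν : Fin 4)
    (z : Fin 4 → ℤ) :
    TbalOf Lc (JsBalAn1 hLc hr cE cVH cΛ cE₂ 0 T₁) j μ ν z - TbalOf Lc (JsBalAn1 hLc hr cE cVH cΛ cE₂ 0 T₀) j μ ν z =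
      TbalOf Lc (JsBalAn1 hLc hr cE' cVH' cΛ' cE₂ 0 T₁) j μ ν z - TbalOf Lc (JsBalAn1 hLc hr cE' cVH' cΛ' cE₂ 0 T₀) j μ ν z := by
  rw [TbalOf_JsBalAn1_dataDiff hLc hr cE cVH cΛ cE₂ 0 0 T₁ T₀ j μ ν z, TbalOf_JsBalAn1_dataDiff hLc hr cE' cVH' cΛ' cE₂ 0 0 T₁ T₀ j μ ν z,
    T2Of_dataDiff_universal (d := 3) (Lc := Lc) cE cVH cΛ cE₂ 0 0 T₁ T₀ hLc cE' cVH' cΛ' (hB_an1 hLc hr) (hmix_an1 hLc hr) j]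

/-- [folklore] … hence its Ward defect is colour-free. -/
theorem unitTable_wardDefect_colour_free (hLc : 1 ≤ Lc) (hr : r ∈ box (3 + 1) Lc) (cE cVH cΛ cE' cVH' cΛ' cE₂ : ℝ) (T₀ T₁ : Fin 4 → Fin 4 → Fin 4 → Fin 4 → ℝ) (j : ℕ)
    (ν : Fin 4) (z : Fin 4 → ℤ) :
    wardDefect (fun a b w => flipK (TbalOf Lc (JsBalAn1 hLc hr cE cVH cΛ cE₂ 0 T₁) j) a b w - flipK (TbalOf Lc (JsBalAn1 hLc hr cE cVH cΛ cE₂ 0 T₀) j) a b w) ν z =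
      wardDefect (fun a b w => flipK (TbalOf Lc (JsBalAn1 hLc hr cE' cVH' cΛ' cE₂ 0 T₁) j) a b w - flipK (TbalOf Lc (JsBalAn1 hLc hr cE' cVH' cΛ' cE₂ 0 T₀) j) a b w) ν z := by
  unfold wardDefect
  refine Finset.sum_congr rfl fun μ _ => ?_
  simp only [OneStepKernelFamily.flipK_apply]
  rw [unitTable_colour_free hLc hr cE cVH cΛ cE' cVH' cΛ' cE₂ T₀ T₁ j μ ν (-(z - unitVec μ)), unitTable_colour_free hLc hr cE cVH cΛ cE' cVH' cΛ' cE₂ T₀ T₁ j μ ν (-z)]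

/-! ## §2 Under `hW` at one level both knobs are quartic polynomials of the colour triple -/

/-- [folklore] **THE WARD-COMPATIBLE (BORDER WEIGHT, TABLE COORDINATE) PAIR IS A PAIR OF POLYNOMIALS OF TOTAL DEGREE ≤ 4 WITHOUT LINEAR PART IN THE COLOUR TRIPLE.**  Fix a level `j`, a
root, `cE₂`, a table line `T₀, T₁`, and two Ward-defect entries `(ν₁, z₁), (ν₂, z₂)` at which the unit border tower `U_j` and the unit table tower `V_j` (both colour-free; read at any
reference colour triple `c⃗₀`) have a NONZERO 2×2 determinant of Ward defects.  Then TWO polynomials `R_B, R_S` (degree ≤ 4, no linear part) give, for EVERY colour triple, `cB`, `s`: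
`hW` at level `j` for `(c⃗; cB; (1−s)T₀ + sT₁)` ⟹ `cB = eval c⃗ R_B ∧ s = eval c⃗ R_S` (Cramer on `D1SymmetryPencil.ward_pencil₂_formula`; numerators from
`D1WardSolvableColourSet.wardDefect_eq_eval_mvPolynomial`). -/
theorem wardKnobs_eq_eval_mvPolynomial (hLc : 1 ≤ Lc) (hr : r ∈ box (3 + 1) Lc) (cE₀ cVH₀ cΛ₀ cE₂ : ℝ) (T₀ T₁ : Fin 4 → Fin 4 → Fin 4 → Fin 4 → ℝ) (j : ℕ) {ν₁ : Fin 4}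
    {z₁ : Fin 4 → ℤ} {ν₂ : Fin 4} {z₂ : Fin 4 → ℤ}
    (hdet : wardDefect (fun a b w => flipK (TbalOf Lc (JsBalAn1 hLc hr cE₀ cVH₀ cΛ₀ cE₂ 1 T₀) j) a b w - flipK (TbalOf Lc (JsBalAn1 hLc hr cE₀ cVH₀ cΛ₀ cE₂ 0 T₀) j) a b w) ν₁ z₁ *
          wardDefect (fun a b w => flipK (TbalOf Lc (JsBalAn1 hLc hr cE₀ cVH₀ cΛ₀ cE₂ 0 T₁) j) a b w - flipK (TbalOf Lc (JsBalAn1 hLc hr cE₀ cVH₀ cΛ₀ cE₂ 0 T₀) j) a b w) ν₂ z₂ -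
        wardDefect (fun a b w => flipK (TbalOf Lc (JsBalAn1 hLc hr cE₀ cVH₀ cΛ₀ cE₂ 1 T₀) j) a b w - flipK (TbalOf Lc (JsBalAn1 hLc hr cE₀ cVH₀ cΛ₀ cE₂ 0 T₀) j) a b w) ν₂ z₂ *
          wardDefect (fun a b w => flipK (TbalOf Lc (JsBalAn1 hLc hr cE₀ cVH₀ cΛ₀ cE₂ 0 T₁) j) a b w - flipK (TbalOf Lc (JsBalAn1 hLc hr cE₀ cVH₀ cΛ₀ cE₂ 0 T₀) j) a b w) ν₁ z₁ ≠ 0) :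
    ∃ R_B R_S : MvPolynomial (Fin 3) ℝ, R_B.totalDegree ≤ 4 ∧ R_B.homogeneousComponent 1 = 0 ∧ R_S.totalDegree ≤ 4 ∧ R_S.homogeneousComponent 1 = 0 ∧
      ∀ cE cVH cΛ cB s : ℝ, WardTransversal (flipK (TbalOf Lc (JsBalAn1 hLc hr cE cVH cΛ cE₂ cB ((1 - s) • T₀ + s • T₁)) j)) →
        cB = MvPolynomial.eval ![cE, cVH, cΛ] R_B ∧ s = MvPolynomial.eval ![cE, cVH, cΛ] R_S := by
  -- the colour-free defects of the two unit towers
  set u : Fin 4 → (Fin 4 → ℤ) → ℝ := fun ν z =>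
    wardDefect (fun a b w => flipK (TbalOf Lc (JsBalAn1 hLc hr cE₀ cVH₀ cΛ₀ cE₂ 1 T₀) j) a b w - flipK (TbalOf Lc (JsBalAn1 hLc hr cE₀ cVH₀ cΛ₀ cE₂ 0 T₀) j) a b w) ν z with hu
  set v : Fin 4 → (Fin 4 → ℤ) → ℝ := fun ν z =>
    wardDefect (fun a b w => flipK (TbalOf Lc (JsBalAn1 hLc hr cE₀ cVH₀ cΛ₀ cE₂ 0 T₁) j) a b w - flipK (TbalOf Lc (JsBalAn1 hLc hr cE₀ cVH₀ cΛ₀ cE₂ 0 T₀) j) a b w) ν z with hv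
  -- the Ward-defect entries of the member `(c⃗; 0; T₀)` at the two pivots, as polynomials
  obtain ⟨Q₁, hQ₁4, hQ₁1, -, hQ₁⟩ := wardDefect_eq_eval_mvPolynomial hLc hr cE₂ 0 ((1 - (0:ℝ)) • T₀ + (0:ℝ) • T₁) j ν₁ z₁
  obtain ⟨Q₂, hQ₂4, hQ₂1, -, hQ₂⟩ := wardDefect_eq_eval_mvPolynomial hLc hr cE₂ 0 ((1 - (0:ℝ)) • T₀ + (0:ℝ) • T₁) j ν₂ z₂
  set D : ℝ := u ν₁ z₁ * v ν₂ z₂ - u ν₂ z₂ * v ν₁ z₁ with hD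
  have hD0 : D ≠ 0 := hdet
  refine ⟨MvPolynomial.C (v ν₁ z₁ / D) * Q₂ - MvPolynomial.C (v ν₂ z₂ / D) * Q₁, MvPolynomial.C (u ν₂ z₂ / D) * Q₁ - MvPolynomial.C (u ν₁ z₁ / D) * Q₂,
    (mvPolynomial_combination_deg_le_four hQ₂4 hQ₂1 hQ₁4 hQ₁1 _ _).1, (mvPolynomial_combination_deg_le_four hQ₂4 hQ₂1 hQ₁4 hQ₁1 _ _).2,
    (mvPolynomial_combination_deg_le_four hQ₁4 hQ₁1 hQ₂4 hQ₂1 _ _).1, (mvPolynomial_combination_deg_le_four hQ₁4 hQ₁1 hQ₂4 hQ₂1 _ _).2, fun cE cVH cΛ cB s hW => ?_⟩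
  -- colour-freeness transports the pivots to `c⃗`
  have hU : ∀ ν z, wardDefect (fun a b w => flipK (TbalOf Lc (JsBalAn1 hLc hr cE cVH cΛ cE₂ 1 T₀) j) a b w - flipK (TbalOf Lc (JsBalAn1 hLc hr cE cVH cΛ cE₂ 0 T₀) j) a b w) ν z = u ν z :=
    fun ν z => unitBorder_wardDefect_colour_free hLc hr cE cVH cΛ cE₀ cVH₀ cΛ₀ cE₂ T₀ j ν z
  have hV : ∀ ν z, wardDefect (fun a b w => flipK (TbalOf Lc (JsBalAn1 hLc hr cE cVH cΛ cE₂ 0 T₁) j) a b w - flipK (TbalOf Lc (JsBalAn1 hLc hr cE cVH cΛ cE₂ 0 T₀) j) a b w) ν z = v ν z :=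
    fun ν z => unitTable_wardDefect_colour_free hLc hr cE cVH cΛ cE₀ cVH₀ cΛ₀ cE₂ T₀ T₁ j ν z
  have hdet' : wardDefect (fun a b w => flipK (TbalOf Lc (JsBalAn1 hLc hr cE cVH cΛ cE₂ 1 T₀) j) a b w - flipK (TbalOf Lc (JsBalAn1 hLc hr cE cVH cΛ cE₂ 0 T₀) j) a b w) ν₁ z₁ *
          wardDefect (fun a b w => flipK (TbalOf Lc (JsBalAn1 hLc hr cE cVH cΛ cE₂ 0 T₁) j) a b w - flipK (TbalOf Lc (JsBalAn1 hLc hr cE cVH cΛ cE₂ 0 T₀) j) a b w) ν₂ z₂ -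
        wardDefect (fun a b w => flipK (TbalOf Lc (JsBalAn1 hLc hr cE cVH cΛ cE₂ 1 T₀) j) a b w - flipK (TbalOf Lc (JsBalAn1 hLc hr cE cVH cΛ cE₂ 0 T₀) j) a b w) ν₂ z₂ *
          wardDefect (fun a b w => flipK (TbalOf Lc (JsBalAn1 hLc hr cE cVH cΛ cE₂ 0 T₁) j) a b w - flipK (TbalOf Lc (JsBalAn1 hLc hr cE cVH cΛ cE₂ 0 T₀) j) a b w) ν₁ z₁ ≠ 0 := by
    rw [hU, hU, hV, hV]; exact hD0
  have hC := ward_pencil₂_formula (P := fun c t => flipK (TbalOf Lc (JsBalAn1 hLc hr cE cVH cΛ cE₂ c ((1 - t) • T₀ + t • T₁)) j))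
    (fun c t a b z => flipK_TbalOf_JsBalAn1_border_table_affine hLc hr cE cVH cΛ cE₂ T₀ T₁ j c t a b z) hdet' hW
  rw [hU, hU, hV, hV, hQ₁ cE cVH cΛ, hQ₂ cE cVH cΛ] at hC
  obtain ⟨hcB, hs⟩ := hC
  refine ⟨?_, ?_⟩
  · rw [hcB]
    simp only [map_sub, map_mul, MvPolynomial.eval_C]
    rw [← hD]
    field_simp
  · rw [hs]
    simp only [map_sub, map_mul, MvPolynomial.eval_C]
    rw [← hD]
    field_simp

/-! ## §3 (D1) under the Ward binder at one level: one quartic equation in the colour triple alone -/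

/-- [folklore] **UNDER THE WARD BINDER AT ONE LEVEL, (D1) ON THE β-LEAD's PINNED FAMILY ALONG A TABLE LINE IS ONE QUARTIC EQUATION IN THE COLOUR TRIPLE ALONE — NO BORDER WEIGHT,
NO TABLE COORDINATE** (pin `cE₂ = Lc^8`, `2 ≤ Lc`).  With GEN 13's universal root-free `Φ, Λ` (reference root `r₀`) and per-root `γ, σ`: for every root `r`, level `j`, table line `T₀, T₁` and
two entries with a nonzero 2×2 determinant of the unit border ∕ unit table Ward defects, there is ONE `E : MvPolynomial (Fin 3) ℝ`, `E.totalDegree ≤ 4`, `E.homogeneousComponent 1 = 0`,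
such that for every `N, c⃗, cB, s`: `hW` at level `j` for the member `(c⃗; cB; (1−s)T₀ + sT₁)` ⟹ ( `D1Drift … N μ ν` ⟺ `γ + eval c⃗ E + Λ T₀ = stepBal N Lc` ). -/
theorem d1Drift_iff_wardNoFreeKnob (hLc : 2 ≤ Lc) {r₀ : Fin (3 + 1) → ℕ} (hr₀ : r₀ ∈ box (3 + 1) Lc) (μ ν : Fin 4) :
    ∃ (Φ : MvPolynomial (Fin 3) ℝ) (Λ : (Fin 4 → Fin 4 → Fin 4 → Fin 4 → ℝ) →ₗ[ℝ] ℝ),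
      Φ.totalDegree ≤ 4 ∧ Φ.homogeneousComponent 1 = 0 ∧ Φ.coeff 0 = 0 ∧
      ∀ (r : Fin (3 + 1) → ℕ) (hr : r ∈ box (3 + 1) Lc), ∃ γ σ : ℝ,
        (∀ (N cE cVH cΛ cB : ℝ) (Tc : Fin 4 → Fin 4 → Fin 4 → Fin 4 → ℝ),
          (D1Drift Lc (JsBalAn1 (one_le_of_two_le hLc) hr cE cVH cΛ ((Lc : ℝ) ^ (2 * (3 + 1))) cB Tc) N μ ν ↔
            γ + MvPolynomial.eval ![cE, cVH, cΛ] Φ + cB * σ + Λ Tc = B12Normalization.stepBal N Lc)) ∧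
        ∀ (j : ℕ) (T₀ T₁ : Fin 4 → Fin 4 → Fin 4 → Fin 4 → ℝ) (cE₀ cVH₀ cΛ₀ : ℝ) (ν₁ : Fin 4) (z₁ : Fin 4 → ℤ) (ν₂ : Fin 4) (z₂ : Fin 4 → ℤ),
          wardDefect (fun a b w => flipK (TbalOf Lc (JsBalAn1 (one_le_of_two_le hLc) hr cE₀ cVH₀ cΛ₀ ((Lc : ℝ) ^ (2 * (3 + 1))) 1 T₀) j) a b w -
                flipK (TbalOf Lc (JsBalAn1 (one_le_of_two_le hLc) hr cE₀ cVH₀ cΛ₀ ((Lc : ℝ) ^ (2 * (3 + 1))) 0 T₀) j) a b w) ν₁ z₁ *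
              wardDefect (fun a b w => flipK (TbalOf Lc (JsBalAn1 (one_le_of_two_le hLc) hr cE₀ cVH₀ cΛ₀ ((Lc : ℝ) ^ (2 * (3 + 1))) 0 T₁) j) a b w -
                flipK (TbalOf Lc (JsBalAn1 (one_le_of_two_le hLc) hr cE₀ cVH₀ cΛ₀ ((Lc : ℝ) ^ (2 * (3 + 1))) 0 T₀) j) a b w) ν₂ z₂ -
            wardDefect (fun a b w => flipK (TbalOf Lc (JsBalAn1 (one_le_of_two_le hLc) hr cE₀ cVH₀ cΛ₀ ((Lc : ℝ) ^ (2 * (3 + 1))) 1 T₀) j) a b w -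
                flipK (TbalOf Lc (JsBalAn1 (one_le_of_two_le hLc) hr cE₀ cVH₀ cΛ₀ ((Lc : ℝ) ^ (2 * (3 + 1))) 0 T₀) j) a b w) ν₂ z₂ *
              wardDefect (fun a b w => flipK (TbalOf Lc (JsBalAn1 (one_le_of_two_le hLc) hr cE₀ cVH₀ cΛ₀ ((Lc : ℝ) ^ (2 * (3 + 1))) 0 T₁) j) a b w -
                flipK (TbalOf Lc (JsBalAn1 (one_le_of_two_le hLc) hr cE₀ cVH₀ cΛ₀ ((Lc : ℝ) ^ (2 * (3 + 1))) 0 T₀) j) a b w) ν₁ z₁ ≠ 0 →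
          ∃ E : MvPolynomial (Fin 3) ℝ, E.totalDegree ≤ 4 ∧ E.homogeneousComponent 1 = 0 ∧
            ∀ (N cE cVH cΛ cB s : ℝ), WardTransversal (flipK (TbalOf Lc (JsBalAn1 (one_le_of_two_le hLc) hr cE cVH cΛ ((Lc : ℝ) ^ (2 * (3 + 1))) cB ((1 - s) • T₀ + s • T₁)) j)) →
              (D1Drift Lc (JsBalAn1 (one_le_of_two_le hLc) hr cE cVH cΛ ((Lc : ℝ) ^ (2 * (3 + 1))) cB ((1 - s) • T₀ + s • T₁)) N μ ν ↔
                γ + MvPolynomial.eval ![cE, cVH, cΛ] E + Λ T₀ = B12Normalization.stepBal N Lc) := by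
  obtain ⟨Φ, Λ, h4, h1, h0, h⟩ := d1Drift_iff_normalForm_universal hLc hr₀ μ ν
  refine ⟨Φ, Λ, h4, h1, h0, fun r hr => ?_⟩
  obtain ⟨γ, σ, hγ⟩ := h r hr
  refine ⟨γ, σ, hγ, fun j T₀ T₁ cE₀ cVH₀ cΛ₀ ν₁ z₁ ν₂ z₂ hdet => ?_⟩
  obtain ⟨R_B, R_S, hB4, hB1, hS4, hS1, hRS⟩ := wardKnobs_eq_eval_mvPolynomial (one_le_of_two_le hLc) hr cE₀ cVH₀ cΛ₀ ((Lc : ℝ) ^ (2 * (3 + 1))) T₀ T₁ j hdet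
  refine ⟨Φ + MvPolynomial.C σ * R_B + MvPolynomial.C (Λ T₁ - Λ T₀) * R_S, ?_, ?_, fun N cE cVH cΛ cB s hW => ?_⟩
  · refine (MvPolynomial.totalDegree_add _ _).trans (max_le ((MvPolynomial.totalDegree_add _ _).trans (max_le h4 ?_)) ?_)
    · exact (MvPolynomial.totalDegree_mul _ _).trans (by rw [MvPolynomial.totalDegree_C, zero_add]; exact hB4)
    · exact (MvPolynomial.totalDegree_mul _ _).trans (by rw [MvPolynomial.totalDegree_C, zero_add]; exact hS4)
  · rw [map_add, map_add, h1, MvPolynomial.homogeneousComponent_C_mul, MvPolynomial.homogeneousComponent_C_mul, hB1, hS1, mul_zero, mul_zero, add_zero, add_zero]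
  · obtain ⟨hcB, hs⟩ := hRS cE cVH cΛ cB s hW
    have hΛ : Λ ((1 - s) • T₀ + s • T₁) = Λ T₀ + s * (Λ T₁ - Λ T₀) := by
      rw [map_add, map_smul, map_smul, smul_eq_mul, smul_eq_mul]; ring
    rw [hγ N cE cVH cΛ cB ((1 - s) • T₀ + s • T₁), hΛ, hcB, hs, map_add, map_add, map_mul, map_mul, MvPolynomial.eval_C, MvPolynomial.eval_C]
    constructor <;> intro hx <;> linarith

end Summit.QuantumFields.BalabanUV.Gaps.D1WardNoFreeKnob

end
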